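import Literature.MathematicalPhysics.QuantumLattice.ApproximatingHamiltonianProofs
import Literature.MathematicalPhysics.QuantumLattice.RegionalNumberCharge
import HarnessLib

/-!
# Second moments of number-like observables in a quantum Gibbs state [folklore]

Topic `MathematicalPhysics/QuantumLattice` (finite-dimensional thermal bookkeeping behind number-fluctuation bounds of
block trial states; consumer: the thermal wedge of the Hubbard summit). For a Hermitian `H` on `Matrix n n ℂ`, the Gibbs
state `⟨·⟩ = Matrix.gibbsState β H` (`FinDimSpectrum.lean`) and observables on the same space, everything is PROVED; no
definition and no named fact:

* `tm_re_gibbsState_centred_mul_self` — the centring identity `Re⟨(A − c)(A − c)⟩ = Var A + (Re⟨A⟩ − c)²` with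
  `Var A = Re⟨A²⟩ − (Re⟨A⟩)²`, for real `c` (`⟨1⟩ = 1` and linearity);
* `tm_re_gibbsState_add_three_mul_self_le` — `Re⟨(P + Q + R)²⟩ ≤ 3 (Re⟨P²⟩ + Re⟨Q²⟩ + Re⟨R²⟩)` for Hermitian `P, Q, R`
  (the operator `3(P² + Q² + R²) − (P + Q + R)² = (P − Q)ᴴ(P − Q) + (Q − R)ᴴ(Q − R) + (P − R)ᴴ(P − R)` is positive
  semidefinite and the Gibbs state of a Hermitian Hamiltonian is positive, `Matrix.gibbsState_nonneg_of_posSemidef`);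
* `tm_re_gibbsState_sub_smul_one_mul_self_le` — for Hermitian `N_A, N_B, N_R` and `N = N_A + N_B + N_R`:
  `Re⟨(N − c)²⟩ ≤ (Re⟨N⟩ − c)² + 3 (Var N_A + Var N_B + Var N_R)` (centre each part at its mean);
* `tm_doubleComm_sub_of_comm`, `tm_doubleComm_sub_smul_of_comm` — the double commutator `N(XN − NX) − (XN − NX)N` of the
  Falk–Bruch inequality does not see summands of `X` commuting with `N`;
* `tm_re_gibbsState_numberDiag_mul_self_le`, `tm_re_gibbsState_totalNumber_mul_self_le` — `Re⟨N_S²⟩ ≤ (#S)²` for the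
  particle number `N_S = diag(s ↦ #(s ∩ S))` of an orbital set `S` (`RegionalNumberCharge.lean`) and `Re⟨N²⟩ ≤ (2|Λ|)²`
  for the total number of the Hubbard Fock space over `Λ` (`(#S)² − N_S²` is a non-negative diagonal matrix).

References: O. Bratteli, D. W. Robinson, *Operator Algebras and Quantum Statistical Mechanics II* (1997), §5.3.1
(positivity and normalisation of Gibbs states); F. J. Dyson, E. H. Lieb, B. Simon, J. Stat. Phys. 18 (1978) 335, §3
(variances and double commutators). All statements are [folklore].
-/

noncomputable section

open Matrix Finset
open scoped ComplexOrder Matrix.Norms.L2Operator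

namespace Literature.MathematicalPhysics.QuantumLattice

/-! ### Generic observables -/

section Generic

variable {n : Type*} [Fintype n] [DecidableEq n] {H : Matrix n n ℂ}

/-- **Centring identity.** `Re⟨(A − c)(A − c)⟩ = (Re⟨A²⟩ − (Re⟨A⟩)²) + (Re⟨A⟩ − c)²` for Hermitian `H`, any observable `A`
and real `c` (`⟨1⟩ = 1` and linearity of the state). [folklore] -/
theorem tm_re_gibbsState_centred_mul_self (hH : H.IsHermitian) [Nonempty n] (β : ℝ) (A : Matrix n n ℂ) (c : ℝ) :
    (gibbsState β H ((A - (c : ℂ) • 1) * (A - (c : ℂ) • 1))).re =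
      ((gibbsState β H (A * A)).re - (gibbsState β H A).re ^ 2) + ((gibbsState β H A).re - c) ^ 2 := by
  have hZ : partitionFn β H ≠ 0 := by
    rw [partitionFn_eq_re hH β, Ne, Complex.ofReal_eq_zero]
    exact (partitionFn_re_pos hH β).ne'
  have h1 : gibbsState β H 1 = 1 := gibbsState_one β H hZ
  have expand : (A - (c : ℂ) • (1 : Matrix n n ℂ)) * (A - (c : ℂ) • 1) =
      A * A - ((2 * c : ℝ) : ℂ) • A + ((c ^ 2 : ℝ) : ℂ) • (1 : Matrix n n ℂ) := by
    simp only [Matrix.sub_mul, Matrix.mul_sub, Matrix.smul_mul, Matrix.mul_smul, Matrix.one_mul, Matrix.mul_one]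
    push_cast
    module
  rw [expand, map_add, map_sub, map_smul, map_smul, h1, smul_eq_mul, smul_eq_mul, mul_one, Complex.add_re,
    Complex.sub_re, Complex.re_ofReal_mul, Complex.ofReal_re]
  ring

/-- **Three-term second-moment inequality.** `Re⟨(P + Q + R)²⟩ ≤ 3 (Re⟨P²⟩ + Re⟨Q²⟩ + Re⟨R²⟩)` for Hermitian `H, P, Q, R`:
`3(P² + Q² + R²) − (P + Q + R)² = (P − Q)ᴴ(P − Q) + (Q − R)ᴴ(Q − R) + (P − R)ᴴ(P − R)` is positive semidefinite and
the Gibbs state of a Hermitian Hamiltonian is positive. [folklore] -/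
theorem tm_re_gibbsState_add_three_mul_self_le (hH : H.IsHermitian) {P Q R : Matrix n n ℂ} (hP : P.IsHermitian)
    (hQ : Q.IsHermitian) (hR : R.IsHermitian) (β : ℝ) :
    (gibbsState β H ((P + Q + R) * (P + Q + R))).re ≤
      3 * ((gibbsState β H (P * P)).re + (gibbsState β H (Q * Q)).re + (gibbsState β H (R * R)).re) := by
  have key : (P + Q + R) * (P + Q + R) + ((P - Q)ᴴ * (P - Q) + (Q - R)ᴴ * (Q - R) + (P - R)ᴴ * (P - R)) =
      (P * P + Q * Q + R * R) + (P * P + Q * Q + R * R) + (P * P + Q * Q + R * R) := by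
    rw [(hP.sub hQ).eq, (hQ.sub hR).eq, (hP.sub hR).eq]
    noncomm_ring
  have hpsd : ((P - Q)ᴴ * (P - Q) + (Q - R)ᴴ * (Q - R) + (P - R)ᴴ * (P - R)).PosSemidef :=
    ((posSemidef_conjTranspose_mul_self _).add (posSemidef_conjTranspose_mul_self _)).add
      (posSemidef_conjTranspose_mul_self _)
  have h0 : 0 ≤ (gibbsState β H ((P - Q)ᴴ * (P - Q) + (Q - R)ᴴ * (Q - R) + (P - R)ᴴ * (P - R))).re :=
    (Complex.nonneg_iff.mp (gibbsState_nonneg_of_posSemidef β hH hpsd)).1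
  have h1 := congrArg (fun X => (gibbsState β H X).re) key
  simp only [map_add, Complex.add_re] at h1 h0
  linarith

/-- **Second moment about `c` of a three-part observable.** For Hermitian `H, N_A, N_B, N_R`, `N = N_A + N_B + N_R` and
real `c`: `Re⟨(N − c)²⟩ ≤ (Re⟨N⟩ − c)² + 3 (Var N_A + Var N_B + Var N_R)` with `Var X = Re⟨X²⟩ − (Re⟨X⟩)²` (centre `N`
and each part at its mean, then the three-term inequality). [folklore] -/
theorem tm_re_gibbsState_sub_smul_one_mul_self_le (hH : H.IsHermitian) [Nonempty n] {NA NB NR N : Matrix n n ℂ}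
    (hNA : NA.IsHermitian) (hNB : NB.IsHermitian) (hNR : NR.IsHermitian) (hN : N = NA + NB + NR) (β c : ℝ) :
    (gibbsState β H ((N - (c : ℂ) • 1) * (N - (c : ℂ) • 1))).re ≤
      ((gibbsState β H N).re - c) ^ 2 +
        3 * (((gibbsState β H (NA * NA)).re - (gibbsState β H NA).re ^ 2) +
          ((gibbsState β H (NB * NB)).re - (gibbsState β H NB).re ^ 2) +
          ((gibbsState β H (NR * NR)).re - (gibbsState β H NR).re ^ 2)) := by
  have hx : (gibbsState β H N).re = (gibbsState β H NA).re + (gibbsState β H NB).re + (gibbsState β H NR).re := by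
    rw [hN, map_add, map_add, Complex.add_re, Complex.add_re]
  have hsplit : N - ((gibbsState β H N).re : ℂ) • (1 : Matrix n n ℂ) =
      (NA - ((gibbsState β H NA).re : ℂ) • 1) + (NB - ((gibbsState β H NB).re : ℂ) • 1) +
        (NR - ((gibbsState β H NR).re : ℂ) • 1) := by
    rw [hx, hN]
    push_cast
    rw [add_smul, add_smul]
    abel
  have h3 := tm_re_gibbsState_add_three_mul_self_le hH (isHermitian_sub_smul hNA isHermitian_one (gibbsState β H NA).re)
    (isHermitian_sub_smul hNB isHermitian_one (gibbsState β H NB).re)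
    (isHermitian_sub_smul hNR isHermitian_one (gibbsState β H NR).re) β
  rw [← hsplit, tm_re_gibbsState_centred_mul_self hH β N, tm_re_gibbsState_centred_mul_self hH β NA,
    tm_re_gibbsState_centred_mul_self hH β NB, tm_re_gibbsState_centred_mul_self hH β NR] at h3
  rw [tm_re_gibbsState_centred_mul_self hH β N c]
  nlinarith [h3]

omit [DecidableEq n] in
/-- The double commutator `N(XN − NX) − (XN − NX)N` is blind to a summand of `X` commuting with `N`. [folklore] -/
theorem tm_doubleComm_sub_of_comm (N X D : Matrix n n ℂ) (h : N * D = D * N) :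
    N * ((X - D) * N - N * (X - D)) - ((X - D) * N - N * (X - D)) * N = N * (X * N - N * X) - (X * N - N * X) * N := by
  rw [doubleComm_sub, doubleComm_of_comm_eq_zero (sub_eq_zero.mpr h), sub_zero]

omit [DecidableEq n] in
/-- The double commutator `N(XN − NX) − (XN − NX)N` is blind to a scalar multiple of an operator commuting with `N`.
[folklore] -/
theorem tm_doubleComm_sub_smul_of_comm (N X D : Matrix n n ℂ) (c : ℂ) (h : N * D = D * N) :
    N * ((X - c • D) * N - N * (X - c • D)) - ((X - c • D) * N - N * (X - c • D)) * N =
      N * (X * N - N * X) - (X * N - N * X) * N :=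
  tm_doubleComm_sub_of_comm N X (c • D) (by rw [Matrix.mul_smul, Matrix.smul_mul, h])

end Generic

/-! ### Particle numbers on the fermionic Fock space -/

section Number

variable {ι : Type*} [DecidableEq ι] [Fintype ι]

/-- **`Re⟨N_S²⟩ ≤ (#S)²`** for the particle number `N_S = diag(s ↦ #(s ∩ S))` of an orbital set `S`, in the Gibbs state of
any Hermitian Hamiltonian on the Fock space `Finset ι → ℂ` (`(#S)² · 1 − N_S²` is diagonal with non-negative entries, the
state is positive and normalised). [folklore] -/
theorem tm_re_gibbsState_numberDiag_mul_self_le {H : Matrix (Finset ι) (Finset ι) ℂ} (hH : H.IsHermitian) (β : ℝ)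
    (S : Finset ι) :
    (gibbsState β H ((diagonal fun s : Finset ι => (((s ∩ S).card : ℕ) : ℂ)) *
        (diagonal fun s : Finset ι => (((s ∩ S).card : ℕ) : ℂ)))).re ≤ (S.card : ℝ) ^ 2 := by
  have hZ : partitionFn β H ≠ 0 := by
    rw [partitionFn_eq_re hH β, Ne, Complex.ofReal_eq_zero]
    exact (partitionFn_re_pos hH β).ne'
  have hdiff : (((S.card : ℝ) ^ 2 : ℝ) : ℂ) • (1 : Matrix (Finset ι) (Finset ι) ℂ) -
      (diagonal fun s : Finset ι => (((s ∩ S).card : ℕ) : ℂ)) * (diagonal fun s : Finset ι => (((s ∩ S).card : ℕ) : ℂ)) =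
      diagonal fun s : Finset ι => (((S.card : ℝ) ^ 2 - ((s ∩ S).card : ℝ) ^ 2 : ℝ) : ℂ) := by
    rw [smul_one_eq_diagonal, diagonal_mul_diagonal, diagonal_sub]
    congr 1
    funext s
    push_cast
    ring
  have hpsd : ((((S.card : ℝ) ^ 2 : ℝ) : ℂ) • (1 : Matrix (Finset ι) (Finset ι) ℂ) -
      (diagonal fun s : Finset ι => (((s ∩ S).card : ℕ) : ℂ)) *
        (diagonal fun s : Finset ι => (((s ∩ S).card : ℕ) : ℂ))).PosSemidef := by
    rw [hdiff]
    refine posSemidef_diagonal_iff.mpr fun s => ?_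
    rw [Complex.zero_le_real, sub_nonneg]
    have hle : ((s ∩ S).card : ℝ) ≤ S.card := by exact_mod_cast Finset.card_le_card Finset.inter_subset_right
    exact pow_le_pow_left₀ (Nat.cast_nonneg _) hle 2
  have h0 := (Complex.nonneg_iff.mp (gibbsState_nonneg_of_posSemidef β hH hpsd)).1
  rw [map_sub, map_smul, gibbsState_one β H hZ, smul_eq_mul, mul_one, Complex.sub_re, Complex.ofReal_re] at h0
  linarith

/-- **`Re⟨N²⟩ ≤ (2|Λ|)²`** for the total particle number `N = Σ_{x,σ} n_{xσ}` of the Hubbard Fock space over a finite site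
set `Λ`, in the Gibbs state of any Hermitian Hamiltonian (`N = N_{all orbitals}`, `#orbitals = 2|Λ|`). [folklore] -/
theorem tm_re_gibbsState_totalNumber_mul_self_le {Λ : Type*} [LinearOrder Λ] [Fintype Λ]
    {H : Matrix (Finset (Orb Λ)) (Finset (Orb Λ)) ℂ} (hH : H.IsHermitian) (β : ℝ) :
    (gibbsState β H ((totalNumber : Matrix (Finset (Orb Λ)) (Finset (Orb Λ)) ℂ) * totalNumber)).re ≤
      (2 * Fintype.card Λ : ℝ) ^ 2 := by
  classical
  rw [totalNumber_eq_numberDiag_univ (Λ := Λ)]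
  refine (tm_re_gibbsState_numberDiag_mul_self_le hH β _).trans_eq ?_
  rw [card_orbs, Finset.card_univ]
  push_cast
  ring

end Number

end Literature.MathematicalPhysics.QuantumLattice
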